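import Literature.NumberTheory.Automorphic.CompletedCohomology
import HarnessLib

/-!
# `TwoAdicBianchiProModularityLevel` (crux stmt-Langlands-15110, route `ParityBlindBianchi`),
# negative side — what a point of `Spf 𝕋(Kᵖ)` (`IsHeckePoint`, the core of the crux's conclusion)
# must satisfy, and the degree-`0` (Eisenstein) eigenfunctions that every level carries

The crux concludes that the Hecke eigenvalues of an icosahedral Artin `σ : Γ_K → GL₂(ℚ̄₂)` form a
continuous `𝒪_{ℚ̄₂}`-valued point (`Literature.NumberTheory.Automorphic.IsHeckePoint`, `ϖ = 2`) of
the big Hecke algebra of the completed cohomology of the `2`-power Bianchi tower.  Recorded here,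
sorry-free and definition-free (refuter cdisprove seat, cycle 1; none of this refutes the crux):

* `not_isHeckePoint_of_subsingleton` — **no point without cohomology**: if every
  `H^i(X_{K(s)}, k/ϖ^t)` of a tower is trivial, no `χ` is a Hecke point unless `ϖ` is a unit.  So the
  conclusion of the crux has no "empty" model (`2 ∉ 𝒪_{ℚ̄₂}ˣ`): occurrence is a statement about
  non-zero Bianchi cohomology, and the finite index set `I` of `IsHeckePoint` cannot be `∅` at any
  stage `t ≥ 1`.
* `IsHeckePoint.lift_mem_span_pow` — **relations descend**: every non-commutative polynomial
  relation among the diagonal Hecke families `(T_{δ j})_{i,s,t}` holding in `𝕋(Kᵖ)` holds for the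
  values `χ` modulo every `ϖ^t`.  This is the exact lever of any isolation (= refutation) argument
  against the crux: a relation among the `T_{v,i}` on the completed cohomology of the tower violated
  `2`-adically by the Frobenius traces of `σ`.  None is known off degree `0`.
* `isHeckePoint_stage_zero` — the stage `t = 0` is free (`k/ϖ⁰ = 0`); the content starts at `t = 1`.
* `heckeFun_const`, `coeffRepresentation_const` — **degree `0` always carries the degree
  character**: constant functions on `𝒢/L` are `Γ`-invariant (classes of `H⁰(X_L, M)`) and are
  eigenfunctions of every double-coset operator `[LgL]` with eigenvalue `|LgL/L|`.  At a
  hyperspecial level this is `T_{v,1} ↦ q_v + 1`, `T_{v,2} ↦ 1`, Hecke polynomial `(X − 1)(X − q_v)`,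
  the eigensystem of the reducible `1 ⊕ ε⁻¹`: `Spf 𝕋(U^2)` is never empty and `IsHeckePoint` without
  the association clause is satisfiable for free — but an irreducible icosahedral `σ` is excluded
  from every degree-`0` point already modulo the maximal ideal (trace in `𝔽₄ ∖ 𝔽₂` at a Frobenius
  of order `5`, versus `q_v + 1 ≡ 0`).  Moral for provers: the point of the crux must come from
  `H¹`/`H²` of the Bianchi tower (torsion allowed), exactly as the route's rationale says.
-/

noncomputable section

set_option linter.dupNamespace false

namespace Summit.Langlands.Langlands.Theorems.TwoAdicBianchiProModularityLevel.Negative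

open Literature.NumberTheory.Automorphic

universe u v

section HeckePoint

variable {k : Type u} [CommRing k] {Γ 𝒢 : Type u} [Group Γ] [Group 𝒢]
  (ι : Γ →* 𝒢) (T : LevelTower 𝒢) (ϖ : k) {J : Type v} (δ : J → 𝒢) (χ : J → k)

/-- **No Hecke point without cohomology.**  If every `H^i(X_{K(s)}, k/ϖ^t)` of the tower is
trivial then the big Hecke algebra is the zero ring, and no `χ` is a point of `Spf 𝕋(Kᵖ)` unless
`ϖ` is a unit (stage `t = 1` would give `0 = 1` in `k/ϖ`). [folklore] -/
theorem not_isHeckePoint_of_subsingleton (hϖ : ¬ IsUnit ϖ)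
    (h : ∀ i s t : ℕ, Subsingleton (towerCohomology k ι T ϖ i s t)) :
    ¬ IsHeckePoint ι T ϖ δ χ := by
  intro hp
  obtain ⟨I, φ, -, -⟩ := hp 1
  have h01 : (0 : bigHeckeAlgebra k ι T ϖ δ) = 1 := by
    refine Subtype.ext (funext fun z => LinearMap.ext fun m => ?_)
    haveI := h z.1 z.2.1 z.2.2
    exact Subsingleton.elim _ _
  have h01' : (0 : modPow k ϖ 1) = 1 := by simpa using congrArg φ h01
  rw [Ideal.Quotient.zero_eq_one_iff, pow_one, Ideal.span_singleton_eq_top] at h01'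
  exact hϖ h01'

/-- **Relations in `𝕋` descend to every Hecke point.**  If an element `F` of the free `k`-algebra
on `J` vanishes on the diagonal Hecke families `(T_{δ j})_{i,s,t}` (the relation `F(T) = 0` holds on
every `H^i(X_{K(s)}, k/ϖ^t)`), then `F(χ) ∈ (ϖ^t)` for every `t` and every point `χ` of
`Spf 𝕋(Kᵖ)`. [folklore] -/
theorem IsHeckePoint.lift_mem_span_pow (h : IsHeckePoint ι T ϖ δ χ) (F : FreeAlgebra k J)
    (hF : FreeAlgebra.lift k (fun j => towerHeckeFamily k ι T ϖ (δ j)) F = 0) (t : ℕ) :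
    FreeAlgebra.lift k χ F ∈ Ideal.span {ϖ ^ t} := by
  obtain ⟨I, φ, -, hφ⟩ := h t
  let ψ : FreeAlgebra k J →ₐ[k] bigHeckeAlgebra k ι T ϖ δ :=
    FreeAlgebra.lift k fun j =>
      ⟨towerHeckeFamily k ι T ϖ (δ j), towerHeckeFamily_mem_bigHeckeAlgebra k ι T ϖ δ j⟩
  have hval : (bigHeckeAlgebra k ι T ϖ δ).val.comp ψ =
      FreeAlgebra.lift k (fun j => towerHeckeFamily k ι T ϖ (δ j)) := by
    refine FreeAlgebra.hom_ext (funext fun j => ?_)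
    simp [ψ]
  have hψ0 : ψ F = 0 := by
    apply Subtype.ext
    have hv := AlgHom.congr_fun hval F
    simp only [AlgHom.comp_apply, Subalgebra.coe_val] at hv
    rw [hv, hF]
    rfl
  have hcomp : φ.comp ψ =
      (Ideal.Quotient.mkₐ k (Ideal.span {ϖ ^ t})).comp (FreeAlgebra.lift k χ) := by
    refine FreeAlgebra.hom_ext (funext fun j => ?_)
    simp [ψ, hφ j]
  have hFF := AlgHom.congr_fun hcomp F
  simp only [AlgHom.comp_apply, hψ0, map_zero, Ideal.Quotient.mkₐ_eq_mk] at hFF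
  exact Ideal.Quotient.eq_zero_iff_mem.mp hFF.symm

/-- The stage `t = 0` of `IsHeckePoint` is free (`k/ϖ⁰ = k/(1) = 0`). [folklore] -/
theorem isHeckePoint_stage_zero :
    ∃ (I : Finset TowerIndex) (φ : bigHeckeAlgebra k ι T ϖ δ →ₐ[k] modPow k ϖ 0),
      (∀ x y : bigHeckeAlgebra k ι T ϖ δ, (∀ z ∈ I, x.1 z = y.1 z) → φ x = φ y) ∧
        ∀ j, φ ⟨towerHeckeFamily k ι T ϖ (δ j), towerHeckeFamily_mem_bigHeckeAlgebra k ι T ϖ δ j⟩ =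
          Ideal.Quotient.mk _ (χ j) := by
  haveI : Subsingleton (modPow k ϖ 0) := Ideal.Quotient.subsingleton_iff.mpr (by simp)
  refine ⟨∅,
    { toFun := fun _ => 0
      map_one' := Subsingleton.elim _ _
      map_mul' := fun _ _ => Subsingleton.elim _ _
      map_zero' := rfl
      map_add' := fun _ _ => Subsingleton.elim _ _
      commutes' := fun _ => Subsingleton.elim _ _ }, fun _ _ _ => rfl, fun _ => Subsingleton.elim _ _⟩

end HeckePoint

section DegreeZero

variable (k : Type u) [CommRing k] {Γ 𝒢 : Type u} [Group Γ] [Group 𝒢]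
  (ι : Γ →* 𝒢) (L : Subgroup 𝒢) (g : 𝒢) (M : Type u) [AddCommGroup M] [Module k M]

/-- **Constants are Hecke eigenfunctions with eigenvalue the degree**: on `Fun(𝒢/L, M)` the
double-coset operator `[LgL]` multiplies the constant function `m` by `|LgL/L|`. [folklore] -/
theorem heckeFun_const (m : M) (h : (ArithmeticQuotient.doubleCosetQuot L g).Finite) :
    ArithmeticQuotient.heckeFun k L g M (Function.const _ m) =
      h.toFinset.card • Function.const _ m := by
  classical
  ext c
  rw [ArithmeticQuotient.heckeFun_apply, dif_pos h]
  simp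

/-- Constant functions on `𝒢/L` are `Γ`-invariant (the image of `M` in `H⁰(X_L, M)`).
[folklore] -/
theorem coeffRepresentation_const (γ : Γ) (m : M) :
    ArithmeticQuotient.coeffRepresentation k ι L M γ (Function.const _ m) = Function.const _ m := by
  ext c
  simp

end DegreeZero

end Summit.Langlands.Langlands.Theorems.TwoAdicBianchiProModularityLevel.Negative

end
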